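/-
Copyright (c) 2026 the pub-hodgecm-mathlib formalisation cell (harness21).  Prover seat hodgecm-mathlib-A-p14 (g32), P6 «MOD programme»,
P6a desk F0P6a-plan (g1) ORGAN DEALS #1 (O-α) «HECKE–SERRE CONSTRUCTOR», FILE α2c; 2026-09-01.
-/
import Literature.AlgebraicGeometry.AbelianSchemes.SerreTensorIdealTranslationKernel
import HarnessLib

/-!
# An `𝒪`-equivariant homomorphism followed by an ideal translation, `f := ψ ≫ ψ_P : A ⟶ B ⟶ B ⊗_𝒪 𝔟`: homomorphism, equivariance, EXACT fibrewise
# kernel `{x ∣ ψ(ι(a)x) = 1 for all a ∈ 𝔭}`, finite ∕ flat ∕ surjective ([MumfordAV1970] §7 Thm. 4; [RapoportSmithlingZhang2020Diagonal] (4.23))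

Topic `AlgebraicGeometry/AbelianSchemes`, namespace `Literature.AlgebraicGeometry.AbelianSchemes.AbelianSchemeOver`.  THEOREMS ONLY (no definition, no named
fact, no `instance`, no notation, no `sorry`; ANY base scheme `S`).  Cell `hodgecm-mathlib` (D-0151), F0/P6 «MOD», P6a desk F0P6a-plan (g1) ORGAN DEALS #1
**(O-α) «HECKE–SERRE CONSTRUCTOR», FILE α2c** = the COMPOSITE of the quotient step and the Serre step in its `ψ_P` orientation, stated GENERICALLY for an
`𝒪`-equivariant homomorphism `ψ : A → B` (INSTANTIATION for (O-α): `B := A.quotientBy u K hcov hG hsm hgc`, `ψ := A.quotientMk u K hcov` typed `A.X ⟶ B.X`,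
`ρ′ := RingAction.quotient …` and `hψ :=` ★ `RingAction.quotientMk_comp_quotient_i` (FILE α1 ★ p846299), `hker :=` ★ `comp_quotientMk_eq_one_iff`, `ψ` finite ∕
flat ∕ surjective by ★ `isFinite_quotientMk_left` ∕ `flat_quotientMk_left hfree` ∕ `quotientMk_left_surjective`); `--supports stmt-HodgeConjecture-24832`,
COUNT-NEUTRAL.  HONEST LABEL: HC_CM is proved only modulo the 2 remaining named inputs (hLiu418 24832, h413 24833) until rung 0 closes; this file discharges none.

## Mathematics

`ψ : A → B` a homomorphism of abelian `S`-schemes intertwining ring actions `ρ` on `A` and `ρ′` on `B` (`ψ ≫ ρ′(a) = ρ(a) ≫ ψ`), `B` commutative; `𝔟 = E′·𝒪ᵐ`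
presented, `P ∈ 𝔟` (`E′P = P`) with coordinate ideal `𝔭`, `ψ_P : B → B ⊗_𝒪 𝔟` (★ `serreTranslate`), `ρ″ := serreAction ρ′` (★).  Then `f := ψ ≫ ψ_P` is a
homomorphism with `ρ(a) ≫ f = f ≫ ρ″(a)` (§1); on geometric fibre points **`x ≫ f = 1 ↔ ∀ a ∈ 𝔭, (x ≫ ρ(a)) ≫ ψ = 1`** (★ `Ker ψ_P = B[𝔭]` + equivariance),
and if `Ker ψ` on fibre points is described by a predicate (`hker`, e.g. «`= σ(s)`, `σ ∈ K`» ★ for `A → A∕K`) then `x ≫ f = 1 ↔ ∀ a ∈ 𝔭, Ker-predicate (x ≫ ρ(a))`;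
`Ker ψ ⊆ Ker f`, `A_s[𝔭] ⊆ Ker f` (§2).  If `ψ` is finite ∕ flat ∕ surjective and `P` has a quasi-inverse row `Q` (`QE′ = Q`, `QP = N`, `PQ = N·E′`, `N ≠ 0`) then so is
`f` (§3).  [MumfordAV1970] §7 Thm. 4 (p. 72); [RapoportSmithlingZhang2020Diagonal] §4 (4.23) p. 21 (`A → A∕C → (A∕C)` transported by the `p`-power quasi-isogeny);
[Conrad2004GrossZagier] §7 Thm. 7.5; [MilneCM2006] §7.

## Contents

* §1 `isMonHom_comp_serreTranslate`, **`i_comp_comp_serreTranslate`** (equivariance of `f`).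
* §2 **`comp_comp_serreTranslate_eq_one_iff`** (exact kernel, generic), **`comp_comp_serreTranslate_eq_one_iff_of_ker`** (with a kernel predicate for `ψ`),
  `comp_comp_serreTranslate_eq_one_of_comp_eq_one` (`Ker ψ ⊆ Ker f`), `comp_comp_serreTranslate_eq_one_of_forall` (`A_s[𝔭] ⊆ Ker f`).
* §3 `isFinite_comp_serreTranslate_left`, `flat_comp_serreTranslate_left`, `surjective_comp_serreTranslate_left`.

## References
* [MumfordAV1970] D. Mumford, *Abelian Varieties* (1970), §7 Thm. 4 (p. 72).
* [RapoportSmithlingZhang2020Diagonal] M. Rapoport, B. Smithling, W. Zhang (2020), §4, (4.23) (p. 21).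
* [Conrad2004GrossZagier] B. Conrad, *Gross–Zagier revisited*, MSRI Publ. 49 (2004), §7 (Thm. 7.5).
* [MilneCM2006] J. S. Milne, *Complex Multiplication* (2006), §7 «𝔞-multiplications» (pp. 58–59).
-/

set_option autoImplicit false

noncomputable section

universe u

open CategoryTheory CategoryTheory.Limits AlgebraicGeometry MonoidalCategory CartesianMonoidalCategory
open scoped MonObj

namespace Literature.AlgebraicGeometry.AbelianSchemes

namespace AbelianSchemeOver

variable {S : Scheme.{u}} {A B : AbelianSchemeOver S} (ψ : A.X ⟶ B.X)
  {O : Type*} [CommRing O] (ρ : A.RingAction O) (ρ' : B.RingAction O) (hψ : ∀ a : O, ψ ≫ ρ'.i a = ρ.i a ≫ ψ)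
  [IsCommMonObj B.X] {m : ℕ} (E' : Matrix (Fin m) (Fin m) O) (hE' : E' * E' = E') (P : Matrix (Fin m) (Fin 1) O)

/-! ## §1 `f = ψ ≫ ψ_P` is an `𝒪`-equivariant homomorphism -/

section Hom

/-- **`f := ψ ≫ ψ_P : A → B ⊗_𝒪 𝔟` is a homomorphism.** [cite: MumfordAV1970, §7 Thm. 4 (p. 72)] [cite: Conrad2004GrossZagier, §7 (Thm. 7.5)] -/
theorem isMonHom_comp_serreTranslate [IsMonHom ψ] : IsMonHom (ψ ≫ serreTranslate ρ' E' hE' P) := by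
  haveI := isMonHom_serreTranslate ρ' E' hE' P
  infer_instance

include hψ in
/-- **EQUIVARIANCE `ρ(a) ≫ f = f ≫ ρ″(a)`** with `ρ″ := serreAction ρ′ E′ hE′` (from `ψ ≫ ρ′(a) = ρ(a) ≫ ψ` and ★ `i_comp_serreTranslate`).
[cite: RapoportSmithlingZhang2020Diagonal, §4 (4.23) (p. 21)] [cite: Conrad2004GrossZagier, §7 (Thm. 7.5)] -/
theorem i_comp_comp_serreTranslate (hP : E' * P = P) (a : O) :
    ρ.i a ≫ (ψ ≫ serreTranslate ρ' E' hE' P) = (ψ ≫ serreTranslate ρ' E' hE' P) ≫ (serreAction ρ' E' hE').i a := by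
  rw [← Category.assoc, ← hψ a, Category.assoc, i_comp_serreTranslate ρ' E' hE' P hP a, Category.assoc]

end Hom

/-! ## §2 The exact kernel of `f` on geometric fibre points -/

section Kernel

include hψ in
/-- **THE KERNEL OF `f = ψ ≫ ψ_P` ON GEOMETRIC FIBRE POINTS** (generic form): if the coordinates of `P` generate `𝔭`, then for `x ∈ A_s(Ω)`,
`x ≫ f = 1 ↔ ∀ a ∈ 𝔭, (x ≫ ρ(a)) ≫ ψ = 1` (★ `Ker ψ_P = B[𝔭]` on points + equivariance). [cite: MumfordAV1970, §7 Thm. 4 (p. 72)] [cite: MilneCM2006, §7] -/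
theorem comp_comp_serreTranslate_eq_one_iff (hP : E' * P = P) {𝔭 : Ideal O} (h𝔭 : Ideal.span (Set.range fun k => P k 0) = 𝔭)
    ⦃Ω : Type u⦄ [Field Ω] (s : Spec (.of Ω) ⟶ S) (x : A.FibrePoints s) :
    x ≫ (ψ ≫ serreTranslate ρ' E' hE' P) = 1 ↔ ∀ a ∈ 𝔭, (x ≫ ρ.i a) ≫ ψ = 1 := by
  rw [← Category.assoc, comp_serreTranslate_eq_one_iff_forall_mem ρ' E' hE' P hP h𝔭]
  refine forall₂_congr fun a _ => ?_
  rw [Category.assoc, hψ a, ← Category.assoc]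

include hψ in
/-- **The kernel of `f` through a KERNEL PREDICATE for `ψ`**: if `y ≫ ψ = 1 ↔ p s y` on geometric fibre points (★ `comp_quotientMk_eq_one_iff` for `A → A∕K`:
`p s y := ∃ σ ∈ K, y = σ(s)`), then `x ≫ f = 1 ↔ ∀ a ∈ 𝔭, p s (x ≫ ρ(a))`. [cite: MumfordAV1970, §7 Thm. 4 (p. 72)] [cite: RapoportSmithlingZhang2020Diagonal, §4 (4.23) (p. 21)] -/
theorem comp_comp_serreTranslate_eq_one_iff_of_ker (hP : E' * P = P) {𝔭 : Ideal O} (h𝔭 : Ideal.span (Set.range fun k => P k 0) = 𝔭)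
    (p : ∀ ⦃Ω : Type u⦄ [Field Ω] [IsAlgClosed Ω] (s : Spec (.of Ω) ⟶ S), A.FibrePoints s → Prop)
    (hker : ∀ ⦃Ω : Type u⦄ [Field Ω] [IsAlgClosed Ω] (s : Spec (.of Ω) ⟶ S) (y : A.FibrePoints s), y ≫ ψ = 1 ↔ p s y)
    ⦃Ω : Type u⦄ [Field Ω] [IsAlgClosed Ω] (s : Spec (.of Ω) ⟶ S) (x : A.FibrePoints s) :
    x ≫ (ψ ≫ serreTranslate ρ' E' hE' P) = 1 ↔ ∀ a ∈ 𝔭, p s (x ≫ ρ.i a) := by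
  rw [comp_comp_serreTranslate_eq_one_iff ψ ρ ρ' hψ E' hE' P hP h𝔭 s x]
  exact forall₂_congr fun a _ => hker s (x ≫ ρ.i a)

include hψ in
/-- **`Ker ψ ⊆ Ker f`** when `Ker ψ` is `ρ`-stable on fibre points: if `x ≫ ψ = 1` implies `(x ≫ ρ(a)) ≫ ψ = 1` for `a ∈ 𝔭` (e.g. `K` `ρ`-stable), then
`x ≫ ψ = 1 → x ≫ f = 1`. [cite: MumfordAV1970, §7 Thm. 4 (p. 72)] -/
theorem comp_comp_serreTranslate_eq_one_of_comp_eq_one (hP : E' * P = P) {𝔭 : Ideal O} (h𝔭 : Ideal.span (Set.range fun k => P k 0) = 𝔭)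
    ⦃Ω : Type u⦄ [Field Ω] (s : Spec (.of Ω) ⟶ S) (x : A.FibrePoints s)
    (hstab : ∀ a ∈ 𝔭, (x ≫ ρ.i a) ≫ ψ = 1) : x ≫ (ψ ≫ serreTranslate ρ' E' hE' P) = 1 :=
  (comp_comp_serreTranslate_eq_one_iff ψ ρ ρ' hψ E' hE' P hP h𝔭 s x).2 hstab

include hψ in
/-- **`A_s[𝔭] ⊆ Ker f`**: a fibre point killed by `ρ(a)` for all `a ∈ 𝔭` is killed by `f`. [cite: MilneCM2006, §7] [cite: MumfordAV1970, §7 Thm. 4 (p. 72)] -/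
theorem comp_comp_serreTranslate_eq_one_of_forall [IsMonHom ψ] (hP : E' * P = P) {𝔭 : Ideal O} (h𝔭 : Ideal.span (Set.range fun k => P k 0) = 𝔭)
    ⦃Ω : Type u⦄ [Field Ω] (s : Spec (.of Ω) ⟶ S) (x : A.FibrePoints s) (hx : ∀ a ∈ 𝔭, x ≫ ρ.i a = 1) :
    x ≫ (ψ ≫ serreTranslate ρ' E' hE' P) = 1 := by
  refine (comp_comp_serreTranslate_eq_one_iff ψ ρ ρ' hψ E' hE' P hP h𝔭 s x).2 fun a ha => ?_
  rw [hx a ha, MonObj.one_comp]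

end Kernel

/-! ## §3 `f` is finite, flat and surjective -/

section Isogeny

variable (Q : Matrix (Fin 1) (Fin m) O) {N : ℕ}

/-- **`f` is FINITE** if `ψ` is and `P` has a quasi-inverse (★ `isFinite_serreTranslate_left`). [cite: Conrad2004GrossZagier, §7 (Thm. 7.5)] -/
theorem isFinite_comp_serreTranslate_left [IsFinite ψ.left] (hN : N ≠ 0) (hP : E' * P = P) (hQ : Q * E' = Q)
    (hQP : Q * P = Matrix.scalar (Fin 1) (N : O)) (hPQ : P * Q = Matrix.scalar (Fin m) (N : O) * E') :
    IsFinite (ψ ≫ serreTranslate ρ' E' hE' P).left := by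
  haveI := isFinite_serreTranslate_left ρ' E' hE' P Q hN hP hQ hQP hPQ
  rw [Over.comp_left]
  infer_instance

/-- **`f` is FLAT** if `ψ` is and `P` has a quasi-inverse (★ `flat_serreTranslate_left`). [cite: Conrad2004GrossZagier, §7 (Thm. 7.5)] -/
theorem flat_comp_serreTranslate_left [Flat ψ.left] (hN : N ≠ 0) (hP : E' * P = P) (hQ : Q * E' = Q)
    (hQP : Q * P = Matrix.scalar (Fin 1) (N : O)) (hPQ : P * Q = Matrix.scalar (Fin m) (N : O) * E') :
    Flat (ψ ≫ serreTranslate ρ' E' hE' P).left := by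
  haveI := flat_serreTranslate_left ρ' E' hE' P Q hN hP hQ hQP hPQ
  rw [Over.comp_left]
  infer_instance

/-- **`f` is SURJECTIVE** if `ψ` is and `P` has a quasi-inverse (★ `surjective_serreTranslate_left`). [cite: Conrad2004GrossZagier, §7 (Thm. 7.5)] -/
theorem surjective_comp_serreTranslate_left [Surjective ψ.left] (hN : N ≠ 0) (hP : E' * P = P) (hQ : Q * E' = Q)
    (hQP : Q * P = Matrix.scalar (Fin 1) (N : O)) (hPQ : P * Q = Matrix.scalar (Fin m) (N : O) * E') :
    Surjective (ψ ≫ serreTranslate ρ' E' hE' P).left := by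
  haveI := surjective_serreTranslate_left ρ' E' hE' P Q hN hP hQ hQP hPQ
  rw [Over.comp_left]
  infer_instance

end Isogeny

end AbelianSchemeOver

end Literature.AlgebraicGeometry.AbelianSchemes
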